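import Literature.Computability.MetaComplexity.DPReconstructionHybridProgram
import Literature.Computability.Complexity.PRGDerandomization
import Literature.Computability.Complexity.PromiseProofs
import HarnessLib

/-!
# Complexity meta: the two pseudorandom-generator steps of Hirahara's Thm. 3.12 (fooling the test's coins and the reconstruction's coins)

Topic `Literature/Computability/MetaComplexity`, circuit layer of the `K`-complexity form of
Hirahara 2021, Thm. 3.12 (ECCC TR21-058, p. 25). The printed proof uses a pseudorandom generator
`G_s : {0,1}^{O(log s)} → {0,1}^s` secure against linear-size circuits twice:

> "By the security property of the pseudorandom generator `G_s`, … there exists a seed `σ` such that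
> `|Pr_z[D(DP_k(x; z); G_s(σ)) = 1] − Pr_w[D(w; G_s(σ)) = 1]| ≥ δ/2`. … Observe that the condition that
> `R^{D_σ}(A(x;w); w) = x` can be checked by a circuit of size `s'` given `w` as input … In particular,
> there exists a seed `σ'` such that `R^{D_σ}(A(x; G_{s'}(σ')); G_{s'}(σ')) = x`."

In the tree's vocabulary (`Fools` / `seedGenerator`, `HardnessVsRandomness.lean`,
`PRGDerandomization.lean`; tests are polynomial-time languages with the rest of the data hard-wired,
`P ⊆ P/poly`, `exists_circuit_hardwire`):

* `DPKCirc.exists_poly_fools_P` — **a generator fooling size-`N` circuits fools every `P`-test with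
  hard-wired input**: for `L' ∈ P` there is a polynomial `q` such that whenever
  `N ≥ (2|h|+2+m) + q(2|h|+2+m) + 2`, `|Pr_σ[⟨h, G_N(σ)↾m⟩ ∈ L'] − Pr_y[⟨h, y⟩ ∈ L']| ≤ ε`;
* `DPKCirc.exists_seed_dpAdvantage` — **the first use**: if `r ↦ [⟨a, ω ‖ r⟩ ∈ D₀]` is fooled for every
  `ω` and the test with random coins `δ`-distinguishes `DP_k(x; ·)`, some seed `σ` gives coins
  `ρ = G_N(σ)↾m` for which the deterministic test `ω ↦ [⟨a, ω ‖ ρ⟩ ∈ D₀]` `(δ − 2ε)`-distinguishes;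
* `DPKCirc.advParamsF`, `DPKCirc.succLang` — the success event
  `w ↦ [hrecF ⟨hparams a n k M j sgn A(x; w) ρ, w⟩ = x]` as a polynomial-time language of `⟨⟨x, params⟩, w⟩`
  (the advice `A(x; w)` by the Goldreich–Levin brick `L53Prog.glFn`), `boolPair_mem_succLang`,
  `succLang_mem_P`;
* `DPKCirc.exists_seed_success` — **the second use**: if the run fed with its own advice succeeds with
  probability `≥ θ > ε` and the generator fools the success circuit with error `ε`, some seed `σ'`
  makes the derandomised run `w = G_N(σ')↾C` succeed.

## References

* S. Hirahara, ECCC TR21-058 (2021), Thm. 3.12 and its proof (pp. 23, 25), Lemma 3.4 (the generator).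
* S. Arora, B. Barak, *Computational Complexity: A Modern Approach*, CUP 2009, Def. 20.2, Lemma 20.3
  (proof: hard-wiring the input), Thm. 6.6.
-/

noncomputable section

namespace Literature.Computability.MetaComplexity

open _root_.Computability Polynomial Complexity Complexity.Brick Complexity.Plumb Complexity.OracleCompose Complexity.HashBricks Finset
open Literature.Computability.Cryptography Cryptography.CondRed Cryptography.GLDec Cryptography.GLBricks Cryptography.GLInv Cryptography.GLProg

namespace DPKCirc

/-! ### Uniform probabilities over two fields -/

/-- **A product event splits into an average of slices**:
`Pr_{u‖w}[P(u, w)] = avg_u Pr_w[P(u, w)]`. [folklore] -/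
theorem uniformProb_split (a b : ℕ) (P : List Bool → List Bool → Prop) :
    uniformProb (a + b) {v | P (v.take a) (v.drop a)} = uniformAvg a fun u => uniformProb b {w | P u w} := by
  classical
  have h := Literature.Computability.Cryptography.sum_vector_add (M := ℝ) a b (fun u w => if P u w then 1 else 0)
  unfold uniformProb uniformAvg
  have hout : ((@Finset.filter _ (fun r : List.Vector Bool (a + b) => r.toList ∈ {v : List Bool | P (v.take a) (v.drop a)})
      (fun _ => Classical.propDecidable _) univ).card : ℝ) =
      ∑ v : List.Vector Bool (a + b), (if P (v.toList.take a) (v.toList.drop a) then (1 : ℝ) else 0) := by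
    rw [Finset.natCast_card_filter]
    exact Finset.sum_congr rfl fun v _ => if_congr Iff.rfl rfl rfl
  have hin : ∀ u : List Bool, ((@Finset.filter _ (fun r : List.Vector Bool b => r.toList ∈ {w : List Bool | P u w})
      (fun _ => Classical.propDecidable _) univ).card : ℝ) =
      ∑ w : List.Vector Bool b, (if P u w.toList then (1 : ℝ) else 0) := fun u => by
    rw [Finset.natCast_card_filter]
    exact Finset.sum_congr rfl fun w _ => if_congr Iff.rfl rfl rfl
  rw [hout, h, pow_add, Finset.sum_div, Finset.sum_div]
  refine Finset.sum_congr rfl fun u _ => ?_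
  dsimp only
  rw [hin, div_div, mul_comm]

/-- **Fubini for two uniform fields**: `avg_u Pr_w[Q(u,w)] = avg_w Pr_u[Q(u,w)]`. [folklore] -/
theorem uniformAvg_uniformProb_comm (a b : ℕ) (Q : List Bool → List Bool → Prop) :
    uniformAvg a (fun u => uniformProb b {w | Q u w}) = uniformAvg b fun w => uniformProb a {u | Q u w} := by
  classical
  unfold uniformProb uniformAvg
  have hL : ∀ u : List Bool, ((@Finset.filter _ (fun r : List.Vector Bool b => r.toList ∈ {w : List Bool | Q u w})
      (fun _ => Classical.propDecidable _) univ).card : ℝ) =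
      ∑ w : List.Vector Bool b, (if Q u w.toList then (1 : ℝ) else 0) := fun u => by
    rw [Finset.natCast_card_filter]
    exact Finset.sum_congr rfl fun w _ => if_congr Iff.rfl rfl rfl
  have hR : ∀ w : List Bool, ((@Finset.filter _ (fun r : List.Vector Bool a => r.toList ∈ {u : List Bool | Q u w})
      (fun _ => Classical.propDecidable _) univ).card : ℝ) =
      ∑ u : List.Vector Bool a, (if Q u.toList w then (1 : ℝ) else 0) := fun w => by
    rw [Finset.natCast_card_filter]
    exact Finset.sum_congr rfl fun u _ => if_congr Iff.rfl rfl rfl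
  simp only [hL, hR, Finset.sum_div]
  rw [Finset.sum_comm]
  refine Finset.sum_congr rfl fun w _ => Finset.sum_congr rfl fun u _ => ?_
  rw [div_div, div_div, mul_comm]

/-- Averages of `ε`-close functions are `ε`-close. [folklore] -/
theorem abs_uniformAvg_sub_le {a : ℕ} {f g : List Bool → ℝ} {ε : ℝ} (h : ∀ u : List Bool, u.length = a → |f u - g u| ≤ ε) :
    |uniformAvg a f - uniformAvg a g| ≤ ε := by
  unfold uniformAvg
  rw [← sub_div, ← Finset.sum_sub_distrib, abs_div, abs_of_pos (by positivity : (0 : ℝ) < 2 ^ a), div_le_iff₀ (by positivity)]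
  calc |∑ x : List.Vector Bool a, (f x.toList - g x.toList)| ≤ ∑ x : List.Vector Bool a, |f x.toList - g x.toList| :=
        Finset.abs_sum_le_sum_abs _ _
    _ ≤ ∑ _x : List.Vector Bool a, ε := Finset.sum_le_sum fun x _ => h _ (by simp)
    _ = ε * 2 ^ a := by rw [Finset.sum_const, Finset.card_univ, card_vector, Fintype.card_bool, nsmul_eq_mul]; push_cast; ring

/-- If an average of differences is large in absolute value, some term is. [folklore] -/
theorem exists_abs_sub_ge {a : ℕ} {f g : List Bool → ℝ} {c : ℝ} (h : c ≤ |uniformAvg a f - uniformAvg a g|) :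
    ∃ u : List Bool, u.length = a ∧ c ≤ |f u - g u| := by
  by_contra hno
  push Not at hno
  have hlt : ∀ x : List.Vector Bool a, |f x.toList - g x.toList| < c := fun x => hno _ (by simp)
  have hsum : |uniformAvg a f - uniformAvg a g| < c := by
    unfold uniformAvg
    rw [← sub_div, ← Finset.sum_sub_distrib, abs_div, abs_of_pos (by positivity : (0 : ℝ) < 2 ^ a), div_lt_iff₀ (by positivity)]
    calc |∑ x : List.Vector Bool a, (f x.toList - g x.toList)| ≤ ∑ x : List.Vector Bool a, |f x.toList - g x.toList| :=
          Finset.abs_sum_le_sum_abs _ _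
      _ < ∑ _x : List.Vector Bool a, c := Finset.sum_lt_sum_of_nonempty Finset.univ_nonempty fun x _ => hlt x
      _ = c * 2 ^ a := by rw [Finset.sum_const, Finset.card_univ, card_vector, Fintype.card_bool, nsmul_eq_mul]; push_cast; ring
  linarith

/-- An event of positive probability has a member of the right length. [folklore] -/
theorem exists_of_uniformProb_pos {ℓ : ℕ} {S : Set (List Bool)} (h : 0 < uniformProb ℓ S) : ∃ σ : List Bool, σ.length = ℓ ∧ σ ∈ S := by
  classical
  by_contra hno
  push Not at hno
  have hempty : (@Finset.filter _ (fun r : List.Vector Bool ℓ => r.toList ∈ S) (fun _ => Classical.propDecidable _) univ) = ∅ :=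
    Finset.filter_eq_empty_iff.2 fun r _ hr => hno r.toList (by simp) hr
  have h0 : uniformProb ℓ S = 0 := by
    unfold uniformProb
    rw [hempty, Finset.card_empty, Nat.cast_zero, zero_div]
  rw [h0] at h
  exact lt_irrefl _ h

/-! ### A generator fooling size-`N` circuits fools every `P`-test with hard-wired input -/

/-- **Fooling `P`-tests with hard-wired input.** For `L' ∈ P` there is a polynomial `q` such that for
all `h, m ≤ N` with `(2|h|+2+m) + q(2|h|+2+m) + 2 ≤ N` and every generator `s ↦ F⟨1^N, s⟩↾N` on
`ℓ`-bit seeds that fools the `B₂`-circuits of size `≤ N` on `N` inputs with error `ε`, the test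
`y ↦ [⟨h, y⟩ ∈ L']` on `m` bits accepts the first `m` pseudorandom bits about as often as `m` random
bits: `|Pr_σ[⟨h, G(σ)↾m⟩ ∈ L'] − Pr_y[⟨h, y⟩ ∈ L']| ≤ ε` (`P ⊆ P/poly` with `h` hard-wired,
`exists_circuit_hardwire`; then `Fools`). [Hirahara 2021 (ECCC TR21-058), proof of Thm. 3.12 (p. 25);
Arora–Barak 2009, Lemma 20.3 (proof)] [cite: Hirahara2021, Thm. 3.12 (proof)] -/
theorem exists_poly_fools_P {L' : Language Bool} (hL' : L' ∈ Classes.P) :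
    ∃ q : Polynomial ℕ, ∀ (h : List Bool) (m N ℓ : ℕ) (F : List Bool → List Bool) (ε : ℝ),
      m ≤ N → (2 * h.length + 2 + m) + q.eval (2 * h.length + 2 + m) + 2 ≤ N →
      Fools (seedGenerator F ℓ N) N ε →
      |uniformProb ℓ {σ | boolPair h (List.takeD m (F (boolPair (unaryEncodeNat N) σ)) false) ∈ L'} -
        uniformProb m {y | boolPair h y ∈ L'}| ≤ ε := by
  classical
  obtain ⟨q, hq⟩ := exists_cktSize_boolPair_of_mem_PPoly (P_subset_PPoly_holds hL')
  refine ⟨q, fun h m N ℓ F ε hmN hsize hfool => ?_⟩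
  obtain ⟨C, hB, hs, hC⟩ := exists_circuit_hardwire (hq h.length m) h rfl hmN
  have hadv := hfool C hB (hs.trans hsize)
  unfold MetaComplexity.prgAdvantage at hadv
  rw [PRGDerand.card_random_eq_uniformProb L' h hmN C hC] at hadv
  have hcard : #{s : Fin ℓ → Bool | C.eval (seedGenerator F ℓ N s) = true} =
      #(@Finset.filter _ (fun v : Fin ℓ → Bool => List.ofFn v ∈ {σ | boolPair h (List.takeD m (F (boolPair (unaryEncodeNat N) σ)) false) ∈ L'})
        (fun _ => Classical.propDecidable _) univ) := by
    refine congrArg Finset.card (Finset.filter_congr fun s _ => ?_)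
    rw [hC, ← Set.mem_iff_boolIndicator]
    have e : (List.ofFn fun j : Fin m => seedGenerator F ℓ N s (Fin.castLE hmN j)) =
        List.takeD m (F (boolPair (unaryEncodeNat N) (List.ofFn s))) false := by
      rw [← ofFn_getD_eq_takeD]
      simp [seedGenerator]
    rw [e]
    rfl
  have hseed : (#{s : Fin ℓ → Bool | C.eval (seedGenerator F ℓ N s) = true} : ℝ) / 2 ^ ℓ =
      uniformProb ℓ {σ | boolPair h (List.takeD m (F (boolPair (unaryEncodeNat N) σ)) false) ∈ L'} := by
    rw [uniformProb_eq_cnt_div, ← card_filter_ofFn_mem_eq_cnt ℓ {σ | boolPair h (List.takeD m (F (boolPair (unaryEncodeNat N) σ)) false) ∈ L'}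
      (inst := fun _ => Classical.propDecidable _), hcard]
  rw [hseed] at hadv
  exact hadv

/-! ### First use: fooling the coins of the test -/

/-- The test with its input re-paired: `⟨⟨a, ω⟩, r⟩ ↦ [⟨a, ω ‖ r⟩ ∈ D₀]`. [folklore] -/
def pairLang (D₀ : Language Bool) : Language Bool :=
  (fanoutFn (fstF ∘ fstF) (concatFn ∘ fanoutFn (sndF ∘ fstF) sndF)) ⁻¹' D₀

/-- Membership in `pairLang`. [folklore] -/
theorem boolPair_mem_pairLang (D₀ : Language Bool) (a ω r : List Bool) :
    boolPair (boolPair a ω) r ∈ pairLang D₀ ↔ boolPair a (ω ++ r) ∈ D₀ := by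
  show fanoutFn (fstF ∘ fstF) (concatFn ∘ fanoutFn (sndF ∘ fstF) sndF) (boolPair (boolPair a ω) r) ∈ D₀ ↔ _
  simp only [fanoutFn_apply, Function.comp_apply, fstF_boolPair, sndF_boolPair, concatFn_boolPair]

/-- `pairLang D₀ ∈ P` for `D₀ ∈ P`. [folklore] -/
theorem pairLang_mem_P {D₀ : Language Bool} (hD₀ : D₀ ∈ Classes.P) : pairLang D₀ ∈ Classes.P :=
  preimage_mem_P hD₀ (fanoutFn_mem_FP (comp_mem_FP fstF_mem_FP fstF_mem_FP)
    (comp_mem_FP concatFn_mem_FP (fanoutFn_mem_FP (comp_mem_FP sndF_mem_FP fstF_mem_FP) sndF_mem_FP)))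

/-- **First use of the generator (the coins of the test).** For `D₀ ∈ P` there is a polynomial `q`
such that: if `N ≥ (2(2|a|+2+nk+k)+2+m) + q(…) + 2`, the generator on `ℓ`-bit seeds fools size `N`
with error `ε`, and the randomised test `(ω; r) ↦ [⟨a, ω ‖ r⟩ ∈ D₀]` (`r ∈ {0,1}ᵐ`) `δ`-distinguishes
`DP_k(x; ·)` from uniform, then for some seed `σ ∈ {0,1}^ℓ` the deterministic test with coins
`ρ = G_N(σ)↾m` `(δ − 2ε)`-distinguishes `DP_k(x; ·)` from uniform (`dpAdvantage`).
[Hirahara 2021 (ECCC TR21-058), proof of Thm. 3.12 ("there exists a seed `σ` such that … `≥ δ/2`")]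
[cite: Hirahara2021, Thm. 3.12 (proof)] -/
theorem exists_seed_dpAdvantage {D₀ : Language Bool} (hD₀ : D₀ ∈ Classes.P) :
    ∃ q : Polynomial ℕ, ∀ (a x : List Bool) (k m N ℓ : ℕ) (F : List Bool → List Bool) (ε δ : ℝ),
      m ≤ N → (2 * (2 * a.length + 2 + (x.length * k + k)) + 2 + m) + q.eval (2 * (2 * a.length + 2 + (x.length * k + k)) + 2 + m) + 2 ≤ N →
      Fools (seedGenerator F ℓ N) N ε → 2 * ε < δ →
      δ ≤ |uniformProb (x.length * k + m) {zr | boolPair a (dpGen k x (zr.take (x.length * k)) ++ zr.drop (x.length * k)) ∈ D₀} -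
        uniformProb (x.length * k + k + m) {y | boolPair a y ∈ D₀}| →
      ∃ σ : List Bool, σ.length = ℓ ∧
        δ - 2 * ε ≤ dpAdvantage k x fun ω => D₀.boolIndicator (boolPair a (ω ++ List.takeD m (F (boolPair (unaryEncodeNat N) σ)) false)) := by
  classical
  obtain ⟨q, hq⟩ := exists_poly_fools_P (pairLang_mem_P hD₀)
  refine ⟨q, fun a x k m N ℓ F ε δ hmN hsize hfool hεδ hadv => ?_⟩
  set n := x.length with hn
  set ρ : List Bool → List Bool := fun σ => List.takeD m (F (boolPair (unaryEncodeNat N) σ)) false with hρ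
  -- per-`ω` fooling, for every `ω` of length `nk + k`
  have hper : ∀ ω : List Bool, ω.length = n * k + k →
      |uniformProb ℓ {σ | boolPair a (ω ++ ρ σ) ∈ D₀} - uniformProb m {r | boolPair a (ω ++ r) ∈ D₀}| ≤ ε := by
    intro ω hω
    have h := hq (boolPair a ω) m N ℓ F ε hmN (by rw [length_boolPair, hω]; exact hsize) hfool
    simp only [boolPair_mem_pairLang] at h
    exact h
  -- the four averages
  set Pr : List Bool → ℝ := fun ω => uniformProb m {r | boolPair a (ω ++ r) ∈ D₀} with hPr
  set Pσ : List Bool → ℝ := fun ω => uniformProb ℓ {σ | boolPair a (ω ++ ρ σ) ∈ D₀} with hPσ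
  have h1 : uniformProb (n * k + m) {zr | boolPair a (dpGen k x (zr.take (n * k)) ++ zr.drop (n * k)) ∈ D₀} =
      uniformAvg (n * k) fun z => Pr (dpGen k x z) :=
    uniformProb_split (n * k) m (fun z r => boolPair a (dpGen k x z ++ r) ∈ D₀)
  have h2 : uniformProb (n * k + k + m) {y | boolPair a y ∈ D₀} = uniformAvg (n * k + k) fun ω => Pr ω := by
    rw [← uniformProb_split (n * k + k) m (fun ω r => boolPair a (ω ++ r) ∈ D₀)]
    simp only [List.take_append_drop]
  -- the two sides of `dpAdvantage` for the seed `σ`, averaged over `σ`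
  set Pz : List Bool → ℝ := fun σ => uniformProb (n * k) {z | boolPair a (dpGen k x z ++ ρ σ) ∈ D₀} with hPz
  set Pω : List Bool → ℝ := fun σ => uniformProb (n * k + k) {ω | boolPair a (ω ++ ρ σ) ∈ D₀} with hPω
  have h3 : uniformAvg ℓ Pz = uniformAvg (n * k) fun z => Pσ (dpGen k x z) :=
    uniformAvg_uniformProb_comm ℓ (n * k) (fun σ z => boolPair a (dpGen k x z ++ ρ σ) ∈ D₀)
  have h4 : uniformAvg ℓ Pω = uniformAvg (n * k + k) fun ω => Pσ ω :=
    uniformAvg_uniformProb_comm ℓ (n * k + k) (fun σ ω => boolPair a (ω ++ ρ σ) ∈ D₀)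
  have h5 : |uniformAvg (n * k) (fun z => Pr (dpGen k x z)) - uniformAvg (n * k) (fun z => Pσ (dpGen k x z))| ≤ ε :=
    abs_uniformAvg_sub_le fun z hz => by
      rw [abs_sub_comm]; exact hper _ (by rw [length_dpGen, hz])
  have h6 : |uniformAvg (n * k + k) (fun ω => Pr ω) - uniformAvg (n * k + k) (fun ω => Pσ ω)| ≤ ε :=
    abs_uniformAvg_sub_le fun ω hω => by rw [abs_sub_comm]; exact hper _ hω
  rw [h1, h2] at hadv
  -- hence the averaged `σ`-gap is `≥ δ − 2ε`
  have hgap : δ - 2 * ε ≤ |uniformAvg ℓ Pz - uniformAvg ℓ Pω| := by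
    rw [h3, h4]
    have := abs_sub_abs_le_abs_sub (uniformAvg (n * k) (fun z => Pr (dpGen k x z)) - uniformAvg (n * k + k) fun ω => Pr ω)
      (uniformAvg (n * k) (fun z => Pσ (dpGen k x z)) - uniformAvg (n * k + k) fun ω => Pσ ω)
    have htri : |(uniformAvg (n * k) (fun z => Pr (dpGen k x z)) - uniformAvg (n * k + k) fun ω => Pr ω) -
        (uniformAvg (n * k) (fun z => Pσ (dpGen k x z)) - uniformAvg (n * k + k) fun ω => Pσ ω)| ≤ 2 * ε := by
      calc _ = |(uniformAvg (n * k) (fun z => Pr (dpGen k x z)) - uniformAvg (n * k) fun z => Pσ (dpGen k x z)) -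
            (uniformAvg (n * k + k) (fun ω => Pr ω) - uniformAvg (n * k + k) fun ω => Pσ ω)| := by ring_nf
        _ ≤ |uniformAvg (n * k) (fun z => Pr (dpGen k x z)) - uniformAvg (n * k) fun z => Pσ (dpGen k x z)| +
            |uniformAvg (n * k + k) (fun ω => Pr ω) - uniformAvg (n * k + k) fun ω => Pσ ω| := abs_sub _ _
        _ ≤ ε + ε := add_le_add h5 h6
        _ = 2 * ε := by ring
    linarith
  obtain ⟨σ, hσ, hge⟩ := exists_abs_sub_ge hgap
  refine ⟨σ, hσ, ?_⟩
  have hdp : dpAdvantage k x (fun ω => D₀.boolIndicator (boolPair a (ω ++ ρ σ))) = |Pz σ - Pω σ| := by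
    have e1 : {z : List Bool | D₀.boolIndicator (boolPair a (dpGen k x z ++ ρ σ)) = true} = {z | boolPair a (dpGen k x z ++ ρ σ) ∈ D₀} :=
      Set.ext fun z => (Set.mem_iff_boolIndicator _ _).symm
    have e2 : {ω : List Bool | D₀.boolIndicator (boolPair a (ω ++ ρ σ)) = true} = {ω | boolPair a (ω ++ ρ σ) ∈ D₀} :=
      Set.ext fun ω => (Set.mem_iff_boolIndicator _ _).symm
    simp only [dpAdvantage, e1, e2, hPz, hPω, ← hn]
  rw [hdp]
  exact hge

/-! ### The success event as a polynomial-time language -/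

section SuccLang

variable (D₀ : Set (List Bool))

/-- The parameter template `P = ⟨a, 1ⁿ, 1ᵏ, 1^M, 1ʲ, [sgn], ·, ρ⟩` of `z = ⟨⟨x, P⟩, w⟩`. [folklore] -/
def PF : List Bool → List Bool := sndF ∘ fstF
/-- `x`. [folklore] -/
def xF : List Bool → List Bool := fstF ∘ fstF
/-- `1^{kn}` from the template. [folklore] -/
noncomputable def knF : List Bool → List Bool := umulFn ∘ fanoutFn (onesFn ∘ nthF 2 ∘ PF) (onesFn ∘ nthF 1 ∘ PF)
/-- The blocks `ω'` of the coins. [folklore] -/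
noncomputable def ωF : List Bool → List Bool := CondGen.fitF knF (takeFn ∘ fanoutFn knF sndF)
/-- **The advice `A(x; w)`** by the Goldreich–Levin brick: `glFn ⟨⟨1ʲ, 1ⁿ⟩, ⟨x, ω'⟩⟩`. [cite: Hirahara2021, Lemma 3.14] -/
noncomputable def advF : List Bool → List Bool :=
  L53Prog.glFn ∘ fanoutFn (fanoutFn (onesFn ∘ nthF 4 ∘ PF) (onesFn ∘ nthF 1 ∘ PF)) (fanoutFn xF ωF)
/-- **The parameters with the advice filled in.** [folklore] -/
noncomputable def advParamsF : List Bool → List Bool :=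
  fanoutFn (nthF 0 ∘ PF) (fanoutFn (nthF 1 ∘ PF) (fanoutFn (nthF 2 ∘ PF) (fanoutFn (nthF 3 ∘ PF) (fanoutFn (nthF 4 ∘ PF)
    (fanoutFn (nthF 5 ∘ PF) (fanoutFn advF (sndPow 6 ∘ PF)))))))
/-- **The success bit** `[hrecF ⟨params with advice, w⟩ = x]`. [folklore] -/
noncomputable def succF : List Bool → List Bool :=
  eqPairFn ∘ fanoutFn (DPHybProg.hrecF D₀ ∘ fanoutFn advParamsF sndF) xF
/-- **The success event** as a language of `⟨⟨x, template⟩, w⟩`. [cite: Hirahara2021, Thm. 3.12 (proof)] -/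
def succLang : Language Bool := {z | succF D₀ z = [true]}

variable {D₀}

/-- **Membership in the success language**: on `⟨⟨x, hparams a n k M j sgn β ρ⟩, w⟩` it is the
success of the run fed with its own advice (the template's advice slot `β` is ignored). [folklore] -/
theorem boolPair_mem_succLang (a x β ρ w : List Bool) (n k M j : ℕ) (sgn : Bool) :
    boolPair (boolPair x (DPHybProg.hparams a n k M j sgn β ρ)) w ∈ succLang D₀ ↔
      DPHybProg.hrecF D₀ (boolPair (DPHybProg.hparams a n k M j sgn (DPHybStr.advice x n k j w) ρ) w) = x := by
  have hP : PF (boolPair (boolPair x (DPHybProg.hparams a n k M j sgn β ρ)) w) = DPHybProg.hparams a n k M j sgn β ρ := by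
    simp [PF, fstF_boolPair, sndF_boolPair]
  have hxF : xF (boolPair (boolPair x (DPHybProg.hparams a n k M j sgn β ρ)) w) = x := by
    simp [xF, fstF_boolPair]
  have hlen : ∀ i : ℕ, (ones i).length = i := fun i => List.length_replicate ..
  have hF1 : nthF 1 (DPHybProg.hparams a n k M j sgn β ρ) = ones n := by
    simp only [DPHybProg.hparams, nthF_succ_boolPair, nthF_zero_boolPair]
  have hF2 : nthF 2 (DPHybProg.hparams a n k M j sgn β ρ) = ones k := by
    simp only [DPHybProg.hparams, nthF_succ_boolPair, nthF_zero_boolPair]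
  have hF4 : nthF 4 (DPHybProg.hparams a n k M j sgn β ρ) = ones j := by
    simp only [DPHybProg.hparams, nthF_succ_boolPair, nthF_zero_boolPair]
  have hkn : knF (boolPair (boolPair x (DPHybProg.hparams a n k M j sgn β ρ)) w) = ones (k * n) := by
    simp only [knF, Function.comp_apply, fanoutFn_apply, hP, hF1, hF2, onesFn_eq_ones, hlen, umulFn_boolPair]
  have hω : ωF (boolPair (boolPair x (DPHybProg.hparams a n k M j sgn β ρ)) w) = CondParams.fitLen (w.take (k * n)) (k * n) := by
    simp only [ωF, Function.comp_apply, fanoutFn_apply, CondGen.fitF_apply, hkn, sndF_boolPair, takeFn_boolPair, hlen]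
  have hadv : advF (boolPair (boolPair x (DPHybProg.hparams a n k M j sgn β ρ)) w) = DPHybStr.advice x n k j w := by
    simp only [advF, Function.comp_apply, fanoutFn_apply, hP, hxF, hω, hF1, hF4, onesFn_eq_ones, hlen, DPHybStr.advice,
      L53Prog.glFn_boolPair]
  have hparams : advParamsF (boolPair (boolPair x (DPHybProg.hparams a n k M j sgn β ρ)) w) =
      DPHybProg.hparams a n k M j sgn (DPHybStr.advice x n k j w) ρ := by
    simp only [advParamsF, fanoutFn_apply, Function.comp_apply, hP, hadv]
    simp only [DPHybProg.hparams, nthF_succ_boolPair, nthF_zero_boolPair, sndPow_succ_boolPair, sndPow_zero_boolPair]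
  show succF D₀ (boolPair (boolPair x (DPHybProg.hparams a n k M j sgn β ρ)) w) = [true] ↔ _
  simp only [succF, Function.comp_apply, fanoutFn_apply, hparams, sndF_boolPair, hxF, eqPairFn_boolPair,
    List.cons.injEq, and_true, decide_eq_true_eq]

/-- `succF ∈ FP` for `D₀ ∈ P`. [folklore] -/
theorem succF_mem_FP (hD₀ : D₀ ∈ Classes.P) : succF D₀ ∈ FP := by
  have hP : PF ∈ FP := comp_mem_FP sndF_mem_FP fstF_mem_FP
  have hx : xF ∈ FP := comp_mem_FP fstF_mem_FP fstF_mem_FP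
  have hfield : ∀ i, nthF i ∘ PF ∈ FP := fun i => comp_mem_FP (nthF_mem_FP i) hP
  have hones : ∀ i, onesFn ∘ nthF i ∘ PF ∈ FP := fun i => comp_mem_FP onesFn_mem_FP (hfield i)
  have hkn : knF ∈ FP := comp_mem_FP umulFn_mem_FP (fanoutFn_mem_FP (hones 2) (hones 1))
  have hω : ωF ∈ FP := CondGen.fitF_mem_FP hkn (comp_mem_FP takeFn_mem_FP (fanoutFn_mem_FP hkn sndF_mem_FP))
  have hadv : advF ∈ FP := comp_mem_FP L53Prog.glFn_mem_FP (fanoutFn_mem_FP (fanoutFn_mem_FP (hones 4) (hones 1)) (fanoutFn_mem_FP hx hω))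
  have hparams : advParamsF ∈ FP :=
    fanoutFn_mem_FP (hfield 0) (fanoutFn_mem_FP (hfield 1) (fanoutFn_mem_FP (hfield 2) (fanoutFn_mem_FP (hfield 3) (fanoutFn_mem_FP (hfield 4)
      (fanoutFn_mem_FP (hfield 5) (fanoutFn_mem_FP hadv (comp_mem_FP (sndPow_mem_FP 6) hP)))))))
  exact comp_mem_FP eqPairFn_mem_FP (fanoutFn_mem_FP (comp_mem_FP (DPHybProg.hrecF_mem_FP D₀ hD₀) (fanoutFn_mem_FP hparams sndF_mem_FP)) hx)

/-- **The success event is in `P`** for `D₀ ∈ P`. [cite: Hirahara2021, Thm. 3.12 (proof)] -/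
theorem succLang_mem_P (hD₀ : D₀ ∈ Classes.P) : succLang D₀ ∈ Classes.P := by
  refine mem_P_of_mem_FP (succF_mem_FP hD₀) (succLang D₀) fun z => ⟨fun hz => hz, fun hz => ?_⟩
  rcases eqPairFn_eq_or (fanoutFn (DPHybProg.hrecF D₀ ∘ fanoutFn advParamsF sndF) xF z) with h | h
  · exact absurd h hz
  · exact h

end SuccLang

/-! ### Second use: fooling the coins of the reconstruction -/

/-- **Second use of the generator (the coins of the reconstruction).** For `D₀ ∈ P` there is a
polynomial `q` such that: if the run fed with its own advice succeeds with probability `≥ θ` over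
`C` coins, the generator on `ℓ`-bit seeds fools size `N ≥ (2|h|+2+C) + q(…) + 2`
(`h = ⟨x, hparams a n k M j sgn [] ρ⟩`) with error `ε < θ`, then some seed `σ' ∈ {0,1}^ℓ` makes the
derandomised run on the coins `G_N(σ')↾C`, fed with its own advice, output `x`.
[Hirahara 2021 (ECCC TR21-058), proof of Thm. 3.12 ("there exists a seed `σ'` such that
`R^{D_σ}(A(x; G_{s'}(σ')); G_{s'}(σ')) = x`")] [cite: Hirahara2021, Thm. 3.12 (proof)] -/
theorem exists_seed_success {D₀ : Language Bool} (hD₀ : D₀ ∈ Classes.P) :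
    ∃ q : Polynomial ℕ, ∀ (a x ρ : List Bool) (n k M j C N ℓ : ℕ) (sgn : Bool) (F : List Bool → List Bool) (ε θ : ℝ),
      C ≤ N →
      (2 * (boolPair x (DPHybProg.hparams a n k M j sgn [] ρ)).length + 2 + C) +
          q.eval (2 * (boolPair x (DPHybProg.hparams a n k M j sgn [] ρ)).length + 2 + C) + 2 ≤ N →
      Fools (seedGenerator F ℓ N) N ε → ε < θ →
      θ ≤ uniformProb C {w | DPHybProg.hrecF D₀ (boolPair (DPHybProg.hparams a n k M j sgn (DPHybStr.advice x n k j w) ρ) w) = x} →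
      ∃ σ : List Bool, σ.length = ℓ ∧
        DPHybProg.hrecF D₀ (boolPair (DPHybProg.hparams a n k M j sgn
            (DPHybStr.advice x n k j (List.takeD C (F (boolPair (unaryEncodeNat N) σ)) false)) ρ)
          (List.takeD C (F (boolPair (unaryEncodeNat N) σ)) false)) = x := by
  obtain ⟨q, hq⟩ := exists_poly_fools_P (succLang_mem_P hD₀)
  refine ⟨q, fun a x ρ n k M j C N ℓ sgn F ε θ hCN hsize hfool hεθ hθ => ?_⟩
  have h := hq (boolPair x (DPHybProg.hparams a n k M j sgn [] ρ)) C N ℓ F ε hCN hsize hfool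
  simp only [boolPair_mem_succLang] at h
  have hpos : 0 < uniformProb ℓ {σ | DPHybProg.hrecF D₀ (boolPair (DPHybProg.hparams a n k M j sgn
      (DPHybStr.advice x n k j (List.takeD C (F (boolPair (unaryEncodeNat N) σ)) false)) ρ)
        (List.takeD C (F (boolPair (unaryEncodeNat N) σ)) false)) = x} := by
    have := abs_sub_le_iff.1 h
    linarith [this.2]
  obtain ⟨σ, hσ, hmem⟩ := exists_of_uniformProb_pos hpos
  exact ⟨σ, hσ, hmem⟩

end DPKCirc

end Literature.Computability.MetaComplexity

end
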